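import Summits.QuantumAdvantage.QuantumAdvantage.Theorems.MobiusLadderLiouvilleNotPPolyStubJacobiSymCodeFP
import Summits.QuantumAdvantage.QuantumAdvantage.Theorems.WbwObfuscatedGluedTreesKowResHalfCoin
import Literature.Computability.Complexity.CodeFPArith
import Literature.Computability.Complexity.LengthCompare
import Mathlib.NumberTheory.LegendreSymbol.JacobiSymbol
import HarnessLib

/-!
# Stub stub_jacobi2_mem_P (line Sketch, crux CircuitNpAcc0)

The witness language of the Jacobi level-set road,
`JACOBI₂ = {w | (N(u) | 2 N(v) + 1) = +1}` — `u` = the first `⌊|w|/2⌋` bits of `w`, `v` =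
the remaining bits, both read as little-endian binary numerals by `bitsToNat` — is in `P`.

The decision procedure is assembled in the tree's typed polynomial-time algebra `CodeFP` from
strings coded by themselves (`strE`): halve the length (the tree's `HalfCoin.codeFP_halfLength`:
binary length, `natDiv`, back to unary by `unOfNatMin`), split (`strTake` / `strDrop`), evaluate
the two halves (`strVal = bitsToNat`, which canonicalises the numerals), form `2 N(v) + 1`
(`natMul`, `natAdd`) and `(N(u) : ℤ)` (`intOfNat`), run the tree's polynomial-time Jacobi
algorithm `stub_jacobiSymCodeFP` (QuantumAdvantage Theorems, binary/Euclid-type Jacobi algorithm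
with reciprocity), and compare the result with `+1` (`intEq`). The resulting one-bit `FP` function
decides the language, so it is in `P` (`mem_P_of_mem_FP`). Theorems only; sorry-free.
-/

set_option linter.dupNamespace false -- `Summit.PneNP.PneNP.…`: summit = sub-problem (D-0017)

namespace Summit.PneNP.PneNP.Theorems.CircuitNpAcc0

open Finset Literature.Computability.Complexity

open Literature.Computability.Complexity.CodeFP (pairE strE natE intE bitE unE)

open Summit.QuantumAdvantage.QuantumAdvantage.Theorems.WbwObfuscatedGluedTrees.KnowledgeOfWalk
  (Residual.HalfCoin.codeFP_halfLength)

/-- **The first half of a string**: `w ↦ w ↾ ⌊|w|/2⌋` (`strTake` after the tree's half-length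
in unary, `HalfCoin.codeFP_halfLength`). -/
theorem jacobi2P_codeFP_take : CodeFP strE strE (fun w : List Bool => w.take (w.length / 2)) :=
  (CodeFP.strTake.comp (Residual.HalfCoin.codeFP_halfLength.pair (CodeFP.id strE))).congr fun _ => rfl

/-- **The second half of a string**: `w ↦ w ⇂ ⌊|w|/2⌋`. -/
theorem jacobi2P_codeFP_drop : CodeFP strE strE (fun w : List Bool => w.drop (w.length / 2)) :=
  (CodeFP.strDrop.comp (Residual.HalfCoin.codeFP_halfLength.pair (CodeFP.id strE))).congr fun _ => rfl

/-- **The top argument** `N(u) : ℤ` — the value of the first half, as a (nonnegative) integer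
code. -/
theorem jacobi2P_codeFP_top :
    CodeFP strE intE (fun w : List Bool => (bitsToNat (w.take (w.length / 2)) : ℤ)) :=
  (CodeFP.intOfNat.comp (CodeFP.strVal.comp jacobi2P_codeFP_take)).congr fun _ => rfl

/-- **The bottom argument** `2 N(v) + 1` — twice the value of the second half plus one (odd and
positive), as a binary numeral. -/
theorem jacobi2P_codeFP_bot :
    CodeFP strE natE (fun w : List Bool => 2 * bitsToNat (w.drop (w.length / 2)) + 1) :=
  (CodeFP.natAdd.comp ((CodeFP.natMul.comp ((CodeFP.const strE (eβ := natE) 2).pair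
    (CodeFP.strVal.comp jacobi2P_codeFP_drop))).pair (CodeFP.const strE (eβ := natE) 1))).congr
      fun _ => rfl

/-- **The membership bit of `JACOBI₂` is computed on codes in polynomial time**:
`w ↦ [(N(u) | 2 N(v) + 1) = 1]`, the Jacobi symbol by `stub_jacobiSymCodeFP`, the comparison with
`+1` by `intEq`. -/
theorem jacobi2P_codeFP_bit : CodeFP strE bitE (fun w : List Bool =>
    decide (jacobiSym (bitsToNat (w.take (w.length / 2)) : ℤ)
      (2 * bitsToNat (w.drop (w.length / 2)) + 1) = 1)) :=
  (CodeFP.intEq.comp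
    ((Summit.QuantumAdvantage.QuantumAdvantage.Theorems.LiouvilleNotPPoly.stub_jacobiSymCodeFP.comp
      (jacobi2P_codeFP_top.pair jacobi2P_codeFP_bot)).pair
        (CodeFP.const strE (eβ := intE) (1 : ℤ)))).congr fun _ => rfl

/-- STUB S3 (`stub_jacobi2_mem_P`): **`JACOBI₂ ∈ P`** (stated with `JACOBI₂` unfolded): split the
word in halves, canonicalise the two numerals, form `2 N(v) + 1`, run the tree's polynomial-time
Jacobi algorithm `stub_jacobiSymCodeFP` (QuantumAdvantage Theorems), compare with `+1`
(`jacobi2P_codeFP_bit`); a language with an `FP` indicator is in `P` (`mem_P_of_mem_FP`). -/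
theorem stub_jacobi2_mem_P :
    {w : List Bool | jacobiSym (bitsToNat (w.take (w.length / 2)) : ℤ)
      (2 * bitsToNat (w.drop (w.length / 2)) + 1) = 1} ∈ Classes.P := by
  obtain ⟨F, hF, hFs⟩ := jacobi2P_codeFP_bit
  refine mem_P_of_mem_FP hF _ fun w => ?_
  have hFw : F w = [decide (jacobiSym (bitsToNat (w.take (w.length / 2)) : ℤ)
      (2 * bitsToNat (w.drop (w.length / 2)) + 1) = 1)] := hFs w
  refine ⟨fun hw => ?_, fun hw => ?_⟩
  · have hw' : jacobiSym (bitsToNat (w.take (w.length / 2)) : ℤ)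
        (2 * bitsToNat (w.drop (w.length / 2)) + 1) = 1 := hw
    rw [hFw, decide_eq_true hw']
  · have hw' : ¬ jacobiSym (bitsToNat (w.take (w.length / 2)) : ℤ)
        (2 * bitsToNat (w.drop (w.length / 2)) + 1) = 1 := hw
    rw [hFw, decide_eq_false hw']

end Summit.PneNP.PneNP.Theorems.CircuitNpAcc0
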